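import Literature.Probability.RandomPlanarGeometry.SAWTriangularDetourSurgery
import HarnessLib

/-!
# The detour-density adapter for Kesten's inequality on the triangular lattice

Topic `Literature/Probability/RandomPlanarGeometry` (self-avoiding walks on `𝕋 = triGraph`; the one-step
ratio limit `c_{N+1}(𝕋)/c_N(𝕋) → μ(𝕋)`, lane «pcv-sawmu», piece K2 block (D) «TRI-DETOUR ADAPTER»).
Source of the method: N. Madras, G. Slade, *The Self-Avoiding Walk* (1993), §7.3, proof of Theorem 7.3.2,
eq. (7.3.9)–(7.3.10) p. 246 (the walks with few occurrences of the pattern are exponentially rare, hence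
`O(c_N / N³)`), fed by the pattern theorem in the form of Lemma 7.2.5; H. Kesten, J. Math. Phys. 4 (1963).

This file converts the detour-density statement `DetourDensityTri` (all but `C · 2^{-⌊N/Q⌋} μ(𝕋)^N` of the
`N`-step walks on `𝕋` have more than `N/(4Q)` tight triangles) into the polynomial form consumed by the
abstract Kesten inequality (`SAWKestenInequalityAbstract`, hypothesis `hP3`):
`#{ω ∈ S_N(𝕋) : J(ω) < a N} ≤ C' c_N(𝕋) / N³` for `N ≥ 1`, with `a = 1/(4Q)` and `C' = 27 Q³ max(C, 0)`
(the bridge `card_triSharp_eq_detourCount : #triSharp ω = detourCount ω` is in `SAWTriangularDetourSurgery`).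

## Contents (namespace `Literature.Probability.RandomPlanarGeometry.SAW`, all PROVED)

* `exp_logMuTri_pow_le_triSawCount` — `μ(𝕋)^N ≤ c_N(𝕋)` (`logMuTri` is an infimum).
* `half_pow_div_mul_cube_le` — the elementary tail `(1/2)^{⌊N/Q⌋} · N³ ≤ 27 Q³` (no real exponents:
  `(k+1)³ ≤ 27 · 2^k` by induction and `N < Q (⌊N/Q⌋ + 1)`).
* **`triKesten_P3`** — the adapter, in the verbatim shape of hypothesis `hP3` of the abstract assembly
  (`S N := triSL N`, `J := #triSharp`), and `triKesten_P3'` — the same with `triSawCount N`.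
-/

noncomputable section

open Finset
open Literature.Probability.LatticeModels Literature.Probability.Percolation SimpleGraph

namespace Literature.Probability.RandomPlanarGeometry.SAW

/-! ### `μ(𝕋)^N ≤ c_N(𝕋)` -/

/-- **`μ(𝕋)^N ≤ c_N(𝕋)`** for every `N`: `logMuTri = inf_M log c_{M+1}/(M+1) ≤ log c_N / N`.
[cite: MadrasSlade1993, §1.2 (1.2.9)] -/
theorem exp_logMuTri_pow_le_triSawCount (N : ℕ) : Real.exp logMuTri ^ N ≤ (triSawCount N : ℝ) := by
  rcases Nat.eq_zero_or_pos N with rfl | hN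
  · rw [pow_zero]
    exact_mod_cast one_le_triSawCount 0
  · obtain ⟨M, rfl⟩ : ∃ M, N = M + 1 := Nat.exists_eq_succ_of_ne_zero hN.ne'
    have hc : (0 : ℝ) < triSawCount (M + 1) := by exact_mod_cast one_le_triSawCount (M + 1)
    have hM : (0 : ℝ) < (M : ℝ) + 1 := by positivity
    have h1 : logMuTri ≤ Real.log (triSawCount (M + 1)) / ((M : ℝ) + 1) := by
      unfold logMuTri
      refine ciInf_le ⟨0, ?_⟩ M
      rintro x ⟨K, rfl⟩
      exact div_nonneg (Real.log_nonneg (by exact_mod_cast one_le_triSawCount (K + 1))) (by positivity)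
    rw [le_div_iff₀ hM] at h1
    rw [← Real.exp_log hc, ← Real.exp_nat_mul]
    refine Real.exp_le_exp.2 ?_
    push_cast
    linarith

/-! ### The elementary tail `(1/2)^{⌊N/Q⌋} N³ ≤ 27 Q³` -/

/-- `(k+1)³ ≤ 27 · 2^k`. [folklore] -/
private theorem succ_pow_three_le_two_pow : ∀ k : ℕ, (k + 1) ^ 3 ≤ 27 * 2 ^ k
  | 0 => by norm_num
  | 1 => by norm_num
  | 2 => by norm_num
  | 3 => by norm_num
  | k + 4 => by
    have ih := succ_pow_three_le_two_pow (k + 3)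
    have h1 : (k + 4 + 1) ^ 3 ≤ 2 * (k + 3 + 1) ^ 3 := by
      have : (k + 5) ^ 3 ≤ 2 * (k + 4) ^ 3 := by nlinarith [sq_nonneg k, Nat.zero_le k]
      simpa using this
    calc (k + 4 + 1) ^ 3 ≤ 2 * (k + 3 + 1) ^ 3 := h1
      _ ≤ 2 * (27 * 2 ^ (k + 3)) := Nat.mul_le_mul_left 2 ih
      _ = 27 * 2 ^ (k + 4) := by ring

/-- **`(1/2)^{⌊N/Q⌋} · N³ ≤ 27 Q³`** (`Q ≥ 1`): the exponential tail beats the cube with an explicit constant.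
[folklore] -/
private theorem half_pow_div_mul_cube_le {Q : ℕ} (hQ : 0 < Q) (N : ℕ) :
    (1 / 2 : ℝ) ^ (N / Q) * (N : ℝ) ^ 3 ≤ 27 * (Q : ℝ) ^ 3 := by
  set k := N / Q with hk
  have hN : N ≤ Q * (k + 1) := (Nat.lt_mul_div_succ N hQ).le
  have h1 : (N : ℝ) ^ 3 ≤ ((Q : ℝ) * ((k : ℝ) + 1)) ^ 3 := by
    have : ((N ^ 3 : ℕ) : ℝ) ≤ (((Q * (k + 1)) ^ 3 : ℕ) : ℝ) := by
      exact_mod_cast Nat.pow_le_pow_left hN 3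
    push_cast at this
    exact this
  have h2 : ((k : ℝ) + 1) ^ 3 ≤ 27 * 2 ^ k := by
    exact_mod_cast succ_pow_three_le_two_pow k
  have h3 : (0 : ℝ) < 2 ^ k := by positivity
  rw [one_div_pow, div_mul_eq_mul_div, one_mul, div_le_iff₀ h3, mul_pow] at *
  calc (N : ℝ) ^ 3 ≤ (Q : ℝ) ^ 3 * ((k : ℝ) + 1) ^ 3 := h1
    _ ≤ (Q : ℝ) ^ 3 * (27 * 2 ^ k) := mul_le_mul_of_nonneg_left h2 (by positivity)
    _ = 27 * (Q : ℝ) ^ 3 * 2 ^ k := by ring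

/-! ### The adapter -/

/-- **Block (D), the detour-density adapter** (hypothesis `hP3` of the abstract Kesten inequality,
instantiated on `𝕋` with `S N := triSL N`, `J := #triSharp`): if all but `C 2^{-⌊N/Q⌋} μ(𝕋)^N` of the
`N`-step walks have more than `N/(4Q)` detours, then with `a := 1/(4Q)` the walks with `J(ω) < a N` number
at most `27 Q³ max(C,0) · #S_N(𝕋) / N³` for every `N ≥ 1` (`μ(𝕋)^N ≤ c_N(𝕋)` and
`(1/2)^{⌊N/Q⌋} N³ ≤ 27 Q³`). [cite: MadrasSlade1993, §7.3 (7.3.9)–(7.3.10) (proof of Theorem 7.3.2)] -/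
theorem triKesten_P3 (h : DetourDensityTri) :
    ∃ a > (0 : ℝ), ∃ C ≥ (0 : ℝ), ∀ N ≥ (1 : ℕ),
      (#((triSL N).filter fun ω => (#(triSharp ω) : ℝ) < a * N) : ℝ) ≤ C * #(triSL N) / (N : ℝ) ^ 3 := by
  classical
  obtain ⟨Q, hQ, C₀, hC₀⟩ := h
  have hQr : (0 : ℝ) < Q := by exact_mod_cast hQ
  refine ⟨1 / (4 * Q), by positivity, 27 * (Q : ℝ) ^ 3 * max C₀ 0, by positivity, fun N hN => ?_⟩
  have hNr : (0 : ℝ) < N := by exact_mod_cast hN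
  -- Step 1: the filter is contained in the density event
  have hsub : #((triSL N).filter fun ω => (#(triSharp ω) : ℝ) < 1 / (4 * (Q : ℝ)) * N) ≤
      {l : List (Site 2) | l ∈ sawLists triGraph (0 : Site 2) N ∧ detourCount l ≤ N / (4 * Q)}.ncard := by
    rw [← Set.ncard_coe_finset]
    refine Set.ncard_le_ncard ?_ ((sawLists_finite triGraph (0 : Site 2) N).subset fun l hl => hl.1)
    intro ω hω
    rw [Finset.coe_filter, Set.mem_setOf_eq, mem_triSL] at hω
    refine ⟨hω.1, ?_⟩
    rw [← card_triSharp_eq_detourCount, Nat.le_div_iff_mul_le (by positivity)]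
    have h' := hω.2
    rw [div_mul_eq_mul_div, one_mul, lt_div_iff₀ (by positivity)] at h'
    exact_mod_cast h'.le
  -- Step 2: the density bound, with `μ^N ≤ c_N` and `C₀ ≤ max C₀ 0`
  have hhalf : (0 : ℝ) ≤ (1 / 2 : ℝ) ^ (N / Q) := by positivity
  have hμ : (0 : ℝ) ≤ Real.exp logMuTri ^ N := by positivity
  have step2 : (#((triSL N).filter fun ω => (#(triSharp ω) : ℝ) < 1 / (4 * (Q : ℝ)) * N) : ℝ) ≤
      max C₀ 0 * (1 / 2 : ℝ) ^ (N / Q) * (triSawCount N : ℝ) := by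
    calc (#((triSL N).filter fun ω => (#(triSharp ω) : ℝ) < 1 / (4 * (Q : ℝ)) * N) : ℝ)
        ≤ (({l : List (Site 2) | l ∈ sawLists triGraph (0 : Site 2) N ∧
            detourCount l ≤ N / (4 * Q)}.ncard : ℕ) : ℝ) := by exact_mod_cast hsub
      _ ≤ C₀ * (1 / 2 : ℝ) ^ (N / Q) * Real.exp logMuTri ^ N := hC₀ N
      _ ≤ max C₀ 0 * (1 / 2 : ℝ) ^ (N / Q) * Real.exp logMuTri ^ N :=
          mul_le_mul_of_nonneg_right (mul_le_mul_of_nonneg_right (le_max_left _ _) hhalf) hμ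
      _ ≤ max C₀ 0 * (1 / 2 : ℝ) ^ (N / Q) * (triSawCount N : ℝ) :=
          mul_le_mul_of_nonneg_left (exp_logMuTri_pow_le_triSawCount N)
            (mul_nonneg (le_max_right _ _) hhalf)
  -- Step 3: the tail `(1/2)^{⌊N/Q⌋} ≤ 27 Q³ / N³`
  have htail : (1 / 2 : ℝ) ^ (N / Q) ≤ 27 * (Q : ℝ) ^ 3 / (N : ℝ) ^ 3 := by
    rw [le_div_iff₀ (by positivity)]
    exact half_pow_div_mul_cube_le hQ N
  have hc : (0 : ℝ) ≤ (triSawCount N : ℝ) := by positivity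
  rw [card_triSL]
  calc (#((triSL N).filter fun ω => (#(triSharp ω) : ℝ) < 1 / (4 * (Q : ℝ)) * N) : ℝ)
      ≤ max C₀ 0 * (1 / 2 : ℝ) ^ (N / Q) * (triSawCount N : ℝ) := step2
    _ ≤ max C₀ 0 * (27 * (Q : ℝ) ^ 3 / (N : ℝ) ^ 3) * (triSawCount N : ℝ) :=
        mul_le_mul_of_nonneg_right (mul_le_mul_of_nonneg_left htail (le_max_right _ _)) hc
    _ = 27 * (Q : ℝ) ^ 3 * max C₀ 0 * (triSawCount N : ℝ) / (N : ℝ) ^ 3 := by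
        field_simp

/-- Block (D) with the count spelled `triSawCount N` (`#S_N(𝕋) = c_N(𝕋)`).
[cite: MadrasSlade1993, §7.3 (7.3.9)–(7.3.10) (proof of Theorem 7.3.2)] -/
theorem triKesten_P3' (h : DetourDensityTri) :
    ∃ a > (0 : ℝ), ∃ C ≥ (0 : ℝ), ∀ N ≥ (1 : ℕ),
      (#((triSL N).filter fun ω => (#(triSharp ω) : ℝ) < a * N) : ℝ) ≤
        C * (triSawCount N : ℝ) / (N : ℝ) ^ 3 := by
  obtain ⟨a, ha, C, hC, h⟩ := triKesten_P3 h
  refine ⟨a, ha, C, hC, fun N hN => ?_⟩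
  rw [← card_triSL]
  exact h N hN

end Literature.Probability.RandomPlanarGeometry.SAW

end
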